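import Summits.CriticalPhenomena.PercolationContinuityZ3.Theorems.PercThresholdOneFragileWeavingGiantExistsChains

/-!
# `FragileWeavingGiantExists` (stmt-CriticalPhenomena-5266) — descendants, cluster containment, weaving and fragility of the tree

Part of the proof of support item `FragileWeavingGiantExists` of route `PercThresholdOne` by the stationary
hierarchical spanning tree of `ℤ³` (see `PercThresholdOneFragileWeavingGiantExistsDefs.lean` for the construction and the overview).
-/

noncomputable section

namespace Summit.CriticalPhenomena.PercolationContinuityZ3.Theorems.FragileGiant

open MeasureTheory
open scoped ENNReal
open Literature.Probability.Percolation Literature.Probability.LatticeModels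
open Literature.Probability.Percolation.DCT16

/-- **No entries into a leaf block**: if the level-`j` digit of `v` is the leaf `b0`, a point whose
parent lies in `B_j(v)` lies in `B_j(v)` itself. -/
theorem mem_blk_of_par_mem_blk (ω : Ω) (hω : ω ∈ goodSet) {j : ℕ} {v : V3} (hv : digit ω v j = b0) {u : V3}
    (hu : par ω u ∈ blk ω j v) : u ∈ blk ω j v := by
  rcases lt_trichotomy (jlev ω u) j with hlt | heq | hgt
  · have h1 : par ω u ∈ blk ω j u := par_mem_blk_of_lt ω hω u hlt
    rw [← blk_eq_of_mem ω hu, blk_eq_of_mem ω h1]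
    exact mem_blk_self ω j u
  · exfalso
    have h1 := (par_spec ω hω u).2.1
    rw [heq, digit_eq_of_mem_blk ω hu le_rfl, hv] at h1
    exact qnext_ne_b0 _ _ (heq ▸ digit_jlev_ne ω hω u) h1.symm
  · exfalso
    obtain ⟨t, ht⟩ := (par_spec ω hω u).2.2
    have h1 := ht j hgt
    rw [digit_eq_of_mem_blk ω hu le_rfl, hv] at h1
    exact b0_ne_pos t h1

/-- **Descendants of a point lie in its leaf block.** -/
theorem mem_blk_of_iterate_par_eq (ω : Ω) (hω : ω ∈ goodSet) {j : ℕ} {v : V3} (hv : digit ω v j = b0)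
    {t : ℕ} {u : V3} (hu : (par ω)^[t] u = v) : u ∈ blk ω j v := by
  induction t generalizing u with
  | zero => simp only [Function.iterate_zero, id_eq] at hu; rw [hu]; exact mem_blk_self ω j v
  | succ t ih =>
    rw [Function.iterate_succ_apply] at hu
    exact mem_blk_of_par_mem_blk ω hω hv (ih hu)

/-- **Every point has finitely many descendants** (on the good event). -/
theorem finite_descendants (ω : Ω) (hω : ω ∈ goodSet) (v : V3) : {u | ∃ t, (par ω)^[t] u = v}.Finite := by
  obtain ⟨j, -, hj⟩ := hω v b0 0
  exact (blk ω j v).finite_toSet.subset fun u ⟨t, ht⟩ => mem_blk_of_iterate_par_eq ω hω hj ht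

/-- **Cluster containment.** In a sub-configuration `T' ⊆ T` a path inside `A` from `x` to `y` forces the
ancestral chains of `y` and `x` to meet, with all chain edges up to the meeting point in `T'` and all chain
vertices in `A`. -/
theorem chains_of_pathIn (ω : Ω) {T' : Set (Sym2 V3)} (hT' : T' ⊆ treeConfig ω) {A : Set V3} {x y : V3}
    (h : PathIn (openGraph T') A x y) :
    ∃ i j, (par ω)^[i] y = (par ω)^[j] x ∧
      (∀ t < i, s((par ω)^[t] y, (par ω)^[t + 1] y) ∈ T') ∧ (∀ t ≤ i, (par ω)^[t] y ∈ A) ∧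
      (∀ t < j, s((par ω)^[t] x, (par ω)^[t + 1] x) ∈ T') ∧ (∀ t ≤ j, (par ω)^[t] x ∈ A) := by
  refine pathIn_induction (fun w => ∃ i j, (par ω)^[i] w = (par ω)^[j] x ∧
      (∀ t < i, s((par ω)^[t] w, (par ω)^[t + 1] w) ∈ T') ∧ (∀ t ≤ i, (par ω)^[t] w ∈ A) ∧
      (∀ t < j, s((par ω)^[t] x, (par ω)^[t + 1] x) ∈ T') ∧ (∀ t ≤ j, (par ω)^[t] x ∈ A)) h ?_ ?_
  · refine ⟨0, 0, rfl, fun t ht => absurd ht (Nat.not_lt_zero _), fun t ht => ?_,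
      fun t ht => absurd ht (Nat.not_lt_zero _), fun t ht => ?_⟩ <;>
    · rw [Nat.le_zero.1 ht]; exact h.left_mem
  · rintro a b - hb ⟨i, j, hij, hea, hva, hex, hvx⟩ hab
    rw [openGraph_adj] at hab
    obtain ⟨hmem, hne⟩ := hab
    obtain ⟨z, hz⟩ := hT' hmem
    simp only at hz
    rw [Sym2.eq_iff] at hz
    rcases hz with ⟨rfl, rfl⟩ | ⟨rfl, rfl⟩
    · -- `b = par a`
      rcases i with _ | i
      · -- `a = par^[j] x`
        simp only [Function.iterate_zero, id_eq] at hij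
        refine ⟨0, j + 1, ?_, fun t ht => absurd ht (Nat.not_lt_zero _), fun t ht => ?_, fun t ht => ?_,
          fun t ht => ?_⟩
        · rw [Function.iterate_succ_apply', ← hij]; rfl
        · rw [Nat.le_zero.1 ht]; exact hb
        · rcases Nat.lt_succ_iff_lt_or_eq.1 ht with ht' | rfl
          · exact hex t ht'
          · rw [Function.iterate_succ_apply', ← hij]; exact hmem
        · rcases Nat.lt_or_eq_of_le ht with ht' | rfl
          · exact hvx t (Nat.lt_succ_iff.1 ht')
          · rw [Function.iterate_succ_apply', ← hij]; exact hb
      · refine ⟨i, j, ?_, fun t ht => ?_, fun t ht => ?_, hex, hvx⟩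
        · rw [← hij, Function.iterate_succ_apply]
        · have := hea (t + 1) (by omega)
          rwa [Function.iterate_succ_apply, Function.iterate_succ_apply (par ω) (t + 1)] at this
        · have := hva (t + 1) (by omega)
          rwa [Function.iterate_succ_apply] at this
    · -- `a = par b`
      refine ⟨i + 1, j, ?_, fun t ht => ?_, fun t ht => ?_, hex, hvx⟩
      · rw [Function.iterate_succ_apply]; exact hij
      · rcases t with _ | t
        · simp only [Function.iterate_zero, id_eq]
          rw [Sym2.eq_swap]; exact hmem
        · rw [Function.iterate_succ_apply, Function.iterate_succ_apply (par ω) (t + 1)]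
          exact hea t (by omega)
      · rcases t with _ | t
        · exact hb
        · rw [Function.iterate_succ_apply]; exact hva t (by omega)

/-- **Finiteness criterion for restricted clusters**: if some exit vertex of `x` lies outside `A`, the
cluster of `x` inside `A` (for any sub-configuration of the tree) is finite. -/
theorem finite_cluster_of_exitVertex_not_mem (ω : Ω) (hω : ω ∈ goodSet) {T' : Set (Sym2 V3)}
    (hT' : T' ⊆ treeConfig ω) {A : Set V3} {x : V3} {n : ℕ} (hn : exitVertex ω n x ∉ A) :
    {y | T' ∈ openConnIn A x y}.Finite := by
  obtain ⟨J, hJ, -⟩ := exists_iterate_eq_exitVertex ω hω x n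
  have hsub : {y | T' ∈ openConnIn A x y} ⊆ ⋃ j ∈ Finset.range J, {u | ∃ t, (par ω)^[t] u = (par ω)^[j] x} := by
    intro y hy
    rw [Set.mem_setOf_eq, mem_openConnIn_iff_pathIn] at hy
    obtain ⟨i, j, hij, -, -, -, hvx⟩ := chains_of_pathIn ω hT' hy
    have hj : j < J := by
      by_contra hj; push Not at hj
      exact hn (hJ ▸ hvx J hj)
    simp only [Set.mem_iUnion, Finset.mem_range, Set.mem_setOf_eq]
    exact ⟨j, hj, i, hij⟩
  exact Set.Finite.subset (Set.Finite.biUnion (Finset.range J).finite_toSet fun j _ =>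
    finite_descendants ω hω _) hsub

/-- An exit vertex of `x` of `i`-min type far below: for every `k` there is a level whose exit vertex has
`i`-th coordinate `< k`. -/
theorem exists_exitVertex_apply_lt (ω : Ω) (hω : ω ∈ goodSet) (x : V3) (i : Fin 3) (k : ℤ) :
    ∃ n, exitVertex ω n x i < k := by
  obtain ⟨M, hM⟩ : ∃ M : ℕ, x i - k < 3 ^ M := by
    obtain ⟨M, hM⟩ := pow_unbounded_of_one_lt (x i - k) (by norm_num : (1 : ℤ) < 3)
    exact ⟨M, hM⟩
  obtain ⟨m₁, hm₁, hd₁⟩ := hω x (syncNeg i) M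
  obtain ⟨n, hn, hdn⟩ := hω x (syncNeg i) (m₁ + 1)
  have hX : exitType ω x n = some i := by
    rw [exitType_rec ω hω x n, hdn, nextType_of_isSync _ (isSync_syncNeg i), syncVal_syncNeg]
  have hne : digit ω x m₁ i ≠ 0 := by
    rw [hd₁]; fin_cases i <;> decide
  have hrel : 3 ^ m₁ ≤ rel ω n x i := pow_le_rel_of_digit_ne_zero ω (by omega) x i hne
  refine ⟨n, ?_⟩
  simp only [exitVertex, hX, ite_true, add_zero]
  have : (3 : ℤ) ^ M ≤ 3 ^ m₁ := pow_le_pow_right₀ (by norm_num) hm₁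
  linarith

/-- An exit vertex of `x` of all-max type far above: for every `k` there is a level whose exit vertex has
`i`-th coordinate `> k`. -/
theorem exists_lt_exitVertex_apply (ω : Ω) (hω : ω ∈ goodSet) (x : V3) (i : Fin 3) (k : ℤ) :
    ∃ n, k < exitVertex ω n x i := by
  obtain ⟨M, hM⟩ : ∃ M : ℕ, k - x i < 3 ^ M := by
    obtain ⟨M, hM⟩ := pow_unbounded_of_one_lt (k - x i) (by norm_num : (1 : ℤ) < 3)
    exact ⟨M, hM⟩
  obtain ⟨m₁, hm₁, hd₁⟩ := hω x b0 M
  obtain ⟨n, hn, hdn⟩ := hω x b0 (m₁ + 1)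
  have hX : exitType ω x n = none := by
    rw [exitType_rec ω hω x n, hdn, nextType_of_isSync _ isSync_b0, syncVal_b0]
  have hne : digit ω x m₁ i ≠ 2 := by rw [hd₁]; show (0 : Fin 3) ≠ 2; decide
  have hrel : rel ω n x i + 3 ^ m₁ ≤ 3 ^ n - 1 := rel_add_pow_le_of_digit_ne_two ω (by omega) x i hne
  refine ⟨n, ?_⟩
  simp only [exitVertex, hX]
  have : (3 : ℤ) ^ M ≤ 3 ^ m₁ := pow_le_pow_right₀ (by norm_num) hm₁
  simp only [reduceCtorEq, ite_false]
  linarith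

/-- **Weaving, lower half-spaces**: clusters of any sub-configuration of the tree inside `{z | k ≤ z i}`
are finite. -/
theorem finite_cluster_halfSpace_ge (ω : Ω) (hω : ω ∈ goodSet) {T' : Set (Sym2 V3)} (hT' : T' ⊆ treeConfig ω)
    (i : Fin 3) (k : ℤ) (x : V3) : {y | T' ∈ openConnIn {z | k ≤ z i} x y}.Finite := by
  obtain ⟨n, hn⟩ := exists_exitVertex_apply_lt ω hω x i k
  exact finite_cluster_of_exitVertex_not_mem ω hω hT' (n := n) (by simp only [Set.mem_setOf_eq, not_le]; exact hn)

/-- **Weaving, upper half-spaces**: clusters of any sub-configuration of the tree inside `{z | z i ≤ k}`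
are finite. -/
theorem finite_cluster_halfSpace_le (ω : Ω) (hω : ω ∈ goodSet) {T' : Set (Sym2 V3)} (hT' : T' ⊆ treeConfig ω)
    (i : Fin 3) (k : ℤ) (x : V3) : {y | T' ∈ openConnIn {z | z i ≤ k} x y}.Finite := by
  obtain ⟨n, hn⟩ := exists_lt_exitVertex_apply ω hω x i k
  exact finite_cluster_of_exitVertex_not_mem ω hω hT' (n := n) (by simp only [Set.mem_setOf_eq, not_le]; exact hn)

/-- The chain edges are lattice edges. -/
theorem upEdges_subset_edgeSet (ω : Ω) (w : V3) (k : ℕ) : (↑(upEdges ω w k) : Set (Sym2 V3)) ⊆ (zdGraph 3).edgeSet := by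
  intro e he
  rw [Finset.mem_coe, upEdges, Finset.mem_image] at he
  obtain ⟨t, -, rfl⟩ := he
  rw [Function.iterate_succ_apply']
  exact mk_par_mem_edgeSet ω _

/-- The first `k` chain edges are `k` distinct edges. -/
theorem card_upEdges (ω : Ω) (hω : ω ∈ goodSet) (w : V3) (k : ℕ) : (upEdges ω w k).card = k := by
  rw [upEdges, Finset.card_image_of_injective _ fun t t' h => ?_, Finset.card_range]
  have hinj := iterate_par_injective ω hω w
  rw [Sym2.eq_iff] at h
  rcases h with ⟨h1, -⟩ | ⟨h1, h2⟩
  · exact hinj h1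
  · have e1 : t = t' + 1 := hinj h1
    have e2 : t + 1 = t' := hinj h2
    omega

/-- On the good event the chains of any point and of the origin meet. -/
theorem exists_meet (ω : Ω) (hω : ω ∈ goodSet) (v : V3) : ∃ i j, (par ω)^[i] v = (par ω)^[j] 0 := by
  obtain ⟨n, hn⟩ := exists_mem_blk ω hω 0 v
  exact exists_iterate_eq_of_mem_blk ω hω hn

/-- The meeting identity. -/
theorem iterate_meetI (ω : Ω) (hω : ω ∈ goodSet) (v : V3) :
    (par ω)^[meetI ω v] v = (par ω)^[meetJ ω v] 0 := by
  classical
  have h1 := exists_meet ω hω v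
  have hI : ∃ j, (par ω)^[meetI ω v] v = (par ω)^[j] 0 := by
    rw [meetI, dif_pos h1]; exact Nat.find_spec h1
  rw [meetJ, dif_pos hI]
  exact Nat.find_spec hI

/-- **Minimality of the meeting pair**: any meeting pair dominates it coordinatewise. -/
theorem meet_le (ω : Ω) (hω : ω ∈ goodSet) (v : V3) {i j : ℕ} (h : (par ω)^[i] v = (par ω)^[j] 0) :
    meetI ω v ≤ i ∧ meetJ ω v ≤ j := by
  classical
  have h1 := exists_meet ω hω v
  have hI : meetI ω v ≤ i := by
    rw [meetI, dif_pos h1]; exact Nat.find_min' h1 ⟨j, h⟩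
  refine ⟨hI, ?_⟩
  have key : (par ω)^[j] 0 = (par ω)^[i - meetI ω v + meetJ ω v] 0 := by
    rw [← h, Function.iterate_add_apply, ← iterate_meetI ω hω v, ← Function.iterate_add_apply,
      Nat.sub_add_cancel hI]
  have := iterate_par_injective ω hω 0 key
  omega

/-- The witness edges are lattice edges. -/
theorem fragEdges_subset_edgeSet (ω : Ω) (v : V3) : (↑(fragEdges ω v) : Set (Sym2 V3)) ⊆ (zdGraph 3).edgeSet := by
  unfold fragEdges; split_ifs <;> exact upEdges_subset_edgeSet ω _ _

/-- The witness edge set has `max (meetI) (meetJ)` elements. -/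
theorem card_fragEdges (ω : Ω) (hω : ω ∈ goodSet) (v : V3) :
    (fragEdges ω v).card = max (meetI ω v) (meetJ ω v) := by
  unfold fragEdges
  split_ifs with h
  · rw [card_upEdges ω hω, max_eq_left h]
  · rw [card_upEdges ω hω, max_eq_right (le_of_not_ge h)]

/-- **The meeting pair is long for far points**: `|v i| ≤ meetI + meetJ`. -/
theorem abs_le_meetI_add_meetJ (ω : Ω) (hω : ω ∈ goodSet) (v : V3) (i : Fin 3) :
    |v i| ≤ meetI ω v + meetJ ω v := by
  have h1 := abs_iterate_par_sub_le ω v i (meetI ω v)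
  have h2 := abs_iterate_par_sub_le ω 0 i (meetJ ω v)
  rw [iterate_meetI ω hω v] at h1
  simp only [Pi.zero_apply, sub_zero] at h2
  rw [abs_sub_comm] at h1
  have := abs_sub_le (v i) (((par ω)^[meetJ ω v] 0) i) 0
  simp only [sub_zero] at this
  linarith

/-- **Thinned connections force the witness edges**: if `0` is joined to `v` by a path of the thinned tree
`T ∩ η` (inside any set), all witness edges of `v` are in `η`. -/
theorem fragEdges_subset_of_pathIn (ω : Ω) (hω : ω ∈ goodSet) {η : Set (Sym2 V3)} {A : Set V3} {v : V3}
    (h : PathIn (openGraph (treeConfig ω ∩ η)) A 0 v) : (↑(fragEdges ω v) : Set (Sym2 V3)) ⊆ η := by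
  obtain ⟨i, j, hij, hev, -, he0, -⟩ := chains_of_pathIn ω Set.inter_subset_left h
  obtain ⟨hI, hJ⟩ := meet_le ω hω v hij
  intro e he
  rw [Finset.mem_coe, fragEdges] at he
  split_ifs at he with hc
  · rw [upEdges, Finset.mem_image] at he
    obtain ⟨t, ht, rfl⟩ := he
    exact (hev t (lt_of_lt_of_le (Finset.mem_range.1 ht) hI)).2
  · rw [upEdges, Finset.mem_image] at he
    obtain ⟨t, ht, rfl⟩ := he
    exact (he0 t (lt_of_lt_of_le (Finset.mem_range.1 ht) hJ)).2

/-- The thinned one-arm event forces the witness edges of some inner boundary point. -/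
theorem thinned_siteToBoundary_subset (ω : Ω) (hω : ω ∈ goodSet) (n : ℕ) :
    {η : Set (Sym2 V3) | treeConfig ω ∩ η ∈ siteToBoundary 3 n} ⊆
      ⋃ v ∈ innerBoundary (zdGraph 3) (box 3 n), {η | (↑(fragEdges ω v) : Set (Sym2 V3)) ⊆ η} := by
  intro η hη
  rw [Set.mem_setOf_eq, mem_siteToBoundary_iff] at hη
  obtain ⟨v, hv, hpath⟩ := hη
  simp only [Set.mem_iUnion, Set.mem_setOf_eq]
  exact ⟨v, hv, fragEdges_subset_of_pathIn ω hω hpath⟩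

/-- **Exponential fragility of the tree.** For a good `ω`, every `q ∈ [0,1]` and every `n`,
`P_q(0 ↔ ∂B(n) in T(ω) ∩ η) ≤ 6 (2n+1)² q^{⌈n/2⌉}`. -/
theorem real_thinned_siteToBoundary_le (ω : Ω) (hω : ω ∈ goodSet) (q : unitInterval) (n : ℕ) :
    (bondPercolation (zdGraph 3) q).real {η | treeConfig ω ∩ η ∈ siteToBoundary 3 n} ≤
      6 * (2 * n + 1) ^ 2 * (q : ℝ) ^ ((n + 1) / 2) := by
  have hq0 : 0 ≤ (q : ℝ) := q.2.1
  have hq1 : (q : ℝ) ≤ 1 := q.2.2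
  calc (bondPercolation (zdGraph 3) q).real {η | treeConfig ω ∩ η ∈ siteToBoundary 3 n}
      ≤ (bondPercolation (zdGraph 3) q).real
          (⋃ v ∈ innerBoundary (zdGraph 3) (box 3 n), {η | (↑(fragEdges ω v) : Set (Sym2 V3)) ⊆ η}) :=
        measureReal_mono (thinned_siteToBoundary_subset ω hω n) (measure_ne_top _ _)
    _ ≤ ∑ v ∈ innerBoundary (zdGraph 3) (box 3 n),
          (bondPercolation (zdGraph 3) q).real {η | (↑(fragEdges ω v) : Set (Sym2 V3)) ⊆ η} :=
        measureReal_biUnion_finset_le _ _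
    _ ≤ ∑ _v ∈ innerBoundary (zdGraph 3) (box 3 n), (q : ℝ) ^ ((n + 1) / 2) := by
        refine Finset.sum_le_sum fun v hv => ?_
        rw [bondPercolation_real_setOf_subset _ _ _ (fragEdges_subset_edgeSet ω v), card_fragEdges ω hω v]
        apply pow_le_pow_of_le_one hq0 hq1
        obtain ⟨i, hi⟩ := exists_eq_of_mem_innerBoundary_box hv
        have h1 := abs_le_meetI_add_meetJ ω hω v i
        have h2 : |v i| = n := by rcases hi with h | h <;> rw [h] <;> simp
        rw [h2] at h1
        have h3 : n ≤ meetI ω v + meetJ ω v := by exact_mod_cast h1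
        omega
    _ ≤ 6 * (2 * n + 1) ^ 2 * (q : ℝ) ^ ((n + 1) / 2) := by
        rw [Finset.sum_const, nsmul_eq_mul]
        have hc := card_innerBoundary_box_le (d := 3) n
        have : ((innerBoundary (zdGraph 3) (box 3 n)).card : ℝ) ≤ 6 * (2 * n + 1) ^ 2 := by
          exact_mod_cast hc
        exact mul_le_mul_of_nonneg_right this (pow_nonneg hq0 _)

/-- The uniform measure of a singleton. -/
theorem unifP_singleton (a : P) : unifP {a} = 27⁻¹ := by
  rw [unifP_apply, Measure.count_singleton, mul_one]

end Summit.CriticalPhenomena.PercolationContinuityZ3.Theorems.FragileGiant
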